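import Summits.KontsevichZagierPeriods.KontsevichZagierPeriods.Theorems.RootDecompWalshStrataWalshSpanWeighted

/-!
# `WalshSpan` proof, part 2/3: the cube normal form, sign cells and Walsh sums

Part 2/3 of the proof of item stmt-KontsevichZagierPeriods-25395 `RootDecompWalshStrata.WalshSpan`
(route RootDecompWalshStrata; decomposition cell decomp-kz, lens 4, gen 2 — port of `section Edges`/Edge W
of `run/shared/lean/pub/decomp-kz/decomp-kz-lens-4/WalshStrata.lean` v2, kernel-checked there).
Files: `…WalshSpanWeighted` (the Walsh span `walshSpanned`, weighted scissors) → `…WalshSpanCells`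
(cube normal form, sign cells, Walsh sums) → `…WalshSpan` (the expansion and `walshSpan_proof`, which
proves the route decl BY NAME). Reused landed/Literature results BY NAME: `LogPolytope.stub_scissors`,
`KZ.ratCast_smul_sub_mem_relations` [KZDilationMove], `KZ.scale`,
`IsSemialgebraic.exists_finset_signDetermined` [SemialgebraicSigns], `KZ.exists_translate`,
`KZ.exists_sub_isBounded`, `volume_setOf_aeval_eq_zero`.

This file: `exists_cubeRep` — a bounded integrand-`1` representation is congruent (translation
`KZ.exists_translate` + rational homothety, rule (2)) to a representation with domain inside the open
unit cube `(0,1)^N` and constant rational integrand; the weighted Walsh cells `cellRep g w`; sign cells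
`cellSet F η`, Walsh polynomials `gPoly F η T = ∏_{p ∈ T} η_p p`, and the Walsh sums
`Σ_{T ⊆ F} sgn(∏_{p∈T} a_p) = 2^|F| · 1[∀ p, a_p > 0]` (`walsh_sum_sign`, `walsh_sum_indicator`).
[KontsevichZagier2001 §1.2 rule (2); folklore (Walsh–Fourier expansion on {±1}ᵏ)]
-/

noncomputable section

open Literature.NumberTheory.Transcendental
open Literature.ModelTheory.ExponentialFields
open MeasureTheory Set
open MvPolynomial (aeval X C)

namespace Summit.KontsevichZagierPeriods.RootDecompWalshStrata.WalshSpanProof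

/-! #### W2 · the cube normal form of a bounded volume -/

/-- The open unit cube `(0,1)^N` is `ℚ`-semialgebraic. [BCR1998 §2.1] -/
theorem isSemialgebraic_cubeSet (N : ℕ) :
    IsSemialgebraic ℚ {x : Fin N → ℝ | ∀ j, 0 < x j ∧ x j < 1} := by
  have h := IsSemialgebraic.biInter (k := ℚ) (R := ℝ) (Finset.univ : Finset (Fin N))
    (fun a => {t : Fin N → ℝ | aeval t (0 : MvPolynomial (Fin N) ℚ) < aeval t (X a)} ∩
      {t | aeval t (X a : MvPolynomial (Fin N) ℚ) < aeval t (1 : MvPolynomial (Fin N) ℚ)})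
    (fun a _ => (isSemialgebraic_setOf_eval_lt _ _).inter (isSemialgebraic_setOf_eval_lt _ _))
  convert h using 1
  ext t
  simp

/-- The open unit cube is bounded. [folklore] -/
theorem isBounded_cubeSet (N : ℕ) : Bornology.IsBounded {x : Fin N → ℝ | ∀ j, 0 < x j ∧ x j < 1} :=
  (isCompact_Icc (a := (0 : Fin N → ℝ)) (b := 1)).isBounded.subset fun _ hx =>
    ⟨fun j => (hx j).1.le, fun j => (hx j).2.le⟩

/-- A weighted Walsh cell as a representation: domain `(0,1)^N ∩ {g > 0}`, constant weight `w`. -/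
def cellRep {N : ℕ} (g : MvPolynomial (Fin N) ℚ) (w : ℚ) : KZ.IntegralRep N where
  domain := {x | (∀ j, 0 < x j ∧ x j < 1) ∧ 0 < aeval x g}
  integrand _ := (w : ℝ)
  isSemialgebraic_domain := (isSemialgebraic_cubeSet N).inter (isSemialgebraic_setOf_eval_pos g)
  isSemialgebraicFunOn_integrand :=
    (isSemialgebraicFunOn_aeval
      ((isSemialgebraic_cubeSet N).inter (isSemialgebraic_setOf_eval_pos g)) (C w)).congr
      fun x _ => by simp only [MvPolynomial.aeval_C, eq_ratCast]
  integrableOn := integrableOn_const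
    (hs := (((isBounded_cubeSet N).subset fun x hx => hx.1).measure_lt_top).ne)

/-- The domain of `cellRep g w` is `(0,1)^N ∩ {g > 0}`. [definition] -/
@[simp] theorem cellRep_domain {N : ℕ} (g : MvPolynomial (Fin N) ℚ) (w : ℚ) :
    (cellRep g w).domain = {x | (∀ j, 0 < x j ∧ x j < 1) ∧ 0 < aeval x g} := rfl

/-- The integrand of `cellRep g w` is the constant `w`. [definition] -/
@[simp] theorem cellRep_integrand {N : ℕ} (g : MvPolynomial (Fin N) ℚ) (w : ℚ) (x : Fin N → ℝ) :
    (cellRep g w).integrand x = (w : ℝ) := rfl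

/-- **Cube normal form.** A bounded integrand-`1` representation is congruent to one with domain in
the open unit cube and constant integer integrand (translation by a rational vector, then the
dilation `u ↦ u / L`). [KontsevichZagier2001 §1.2 rule (2); ViuSos2021 §4.1] -/
theorem exists_cubeRep {N : ℕ} (A : KZ.IntegralRep N) (hbd : Bornology.IsBounded A.domain)
    (h1 : ∀ x ∈ A.domain, A.integrand x = 1) :
    ∃ (r : KZ.IntegralRep N) (w : ℚ), (∀ x ∈ r.domain, ∀ j, 0 < x j ∧ x j < 1) ∧
      (∀ x ∈ r.domain, r.integrand x = (w : ℝ)) ∧ KZ.of A - KZ.of r ∈ KZ.relations := by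
  classical
  obtain ⟨C₀, hC⟩ := hbd.exists_norm_le
  set R₀ : ℕ := ⌈C₀⌉₊ + 1 with hR₀
  have hCR : C₀ < R₀ := by
    have h := Nat.le_ceil C₀
    have : (R₀ : ℝ) = (⌈C₀⌉₊ : ℝ) + 1 := by simp [hR₀]
    linarith
  set L : ℕ := 2 * R₀ with hL
  have hLR : (L : ℝ) = 2 * R₀ := by simp [hL]
  have hR₀pos : (0 : ℝ) < R₀ := by
    have : (1 : ℝ) ≤ R₀ := by simp [hR₀]
    linarith
  have hLpos : (0 : ℝ) < L := by rw [hLR]; positivity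
  have hL0 : (L : ℝ) ≠ 0 := hLpos.ne'
  -- translate by `R₀ · 𝟙`
  obtain ⟨r₁, hd₁, hi₁, hrel₁⟩ := KZ.exists_translate A (fun _ => (R₀ : ℚ))
  have hw : (fun _ : Fin N => ((R₀ : ℚ) : ℝ)) = fun _ => (R₀ : ℝ) := funext fun _ => by push_cast; rfl
  rw [hw] at hd₁ hi₁
  have hmem₁ : ∀ x ∈ r₁.domain, (x - fun _ => (R₀ : ℝ)) ∈ A.domain := fun x hx => by
    rw [hd₁] at hx; exact hx
  have hbox : ∀ x ∈ r₁.domain, ∀ j, 0 < x j ∧ x j < L := by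
    intro x hx j
    have hn := hC _ (hmem₁ x hx)
    have hj : |x j - R₀| ≤ C₀ := by
      have := norm_le_pi_norm (x - fun _ => (R₀ : ℝ)) j
      rw [Real.norm_eq_abs, Pi.sub_apply] at this
      exact this.trans hn
    rw [abs_le] at hj
    constructor
    · linarith [hj.1]
    · rw [hLR]; linarith [hj.2]
  have hi₁' : ∀ x ∈ r₁.domain, r₁.integrand x = 1 := fun x hx => by
    rw [hi₁]; exact h1 _ (hmem₁ x hx)
  -- dilate by `1/L`
  have hpoly : (fun (y : Fin N → ℝ) (j : Fin N) =>
      aeval y (C (L : ℚ) * X j : MvPolynomial (Fin N) ℚ)) = fun y => (L : ℝ) • y := by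
    funext y j
    simp [Pi.smul_apply, smul_eq_mul]
  have hdom : IsSemialgebraic ℚ ((fun y : Fin N → ℝ => (L : ℝ) • y) ⁻¹' r₁.domain) := by
    have := r₁.isSemialgebraic_domain.preimage_aeval
      (fun j : Fin N => (C (L : ℚ) * X j : MvPolynomial (Fin N) ℚ))
    rwa [hpoly] at this
  have hsub : (fun y : Fin N → ℝ => (L : ℝ) • y) ⁻¹' r₁.domain ⊆ {x | ∀ j, 0 < x j ∧ x j < 1} := by
    intro y hy j
    have h := hbox _ hy j
    simp only [Pi.smul_apply, smul_eq_mul] at h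
    exact ⟨(mul_pos_iff_of_pos_left hLpos).mp h.1, (mul_lt_iff_lt_one_right hLpos).mp h.2⟩
  let r : KZ.IntegralRep N :=
    { domain := (fun y : Fin N → ℝ => (L : ℝ) • y) ⁻¹' r₁.domain
      integrand := fun _ => (((L : ℚ) ^ N : ℚ) : ℝ)
      isSemialgebraic_domain := hdom
      isSemialgebraicFunOn_integrand := (isSemialgebraicFunOn_aeval hdom (C ((L : ℚ) ^ N))).congr
        fun x _ => by simp only [MvPolynomial.aeval_C, eq_ratCast]
      integrableOn := integrableOn_const
        (hs := (((isBounded_cubeSet N).subset hsub).measure_lt_top).ne) }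
  refine ⟨r, (L : ℚ) ^ N, fun x hx => hsub hx, fun x _ => rfl, ?_⟩
  have hs : (1 / (L : ℚ)) ≠ 0 := one_div_ne_zero (by exact_mod_cast hL0)
  have hcast : (((1 / (L : ℚ)) : ℚ) : ℝ) = (L : ℝ)⁻¹ := by push_cast; rw [one_div]
  have h2 : KZ.of r₁ - KZ.of r ∈ KZ.relations := by
    refine KZ.ratCast_smul_sub_mem_relations hs r₁ r ?_ ?_
    · ext y
      rw [hcast]
      constructor
      · intro hy
        exact ⟨(L : ℝ) • y, hy, by simp only [smul_smul, inv_mul_cancel₀ hL0, one_smul]⟩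
      · rintro ⟨x, hx, rfl⟩
        show (L : ℝ) • ((L : ℝ)⁻¹ • x) ∈ r₁.domain
        rw [smul_smul, mul_inv_cancel₀ hL0, one_smul]
        exact hx
    · intro x hx
      rw [hi₁' x hx, hcast]
      show (1 : ℝ) = (((L : ℚ) ^ N : ℚ) : ℝ) * |(L : ℝ)⁻¹| ^ N
      push_cast
      rw [abs_of_pos (inv_pos.mpr hLpos), ← mul_pow, mul_inv_cancel₀ hL0, one_pow]
  have : KZ.of A - KZ.of r = (KZ.of A - KZ.of r₁) + (KZ.of r₁ - KZ.of r) := by abel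
  rw [this]
  exact KZ.relations.add_mem (KZ.changeOfVariablesRel_subset_relations hrel₁) h2

/-! #### W3 · the Walsh expansion of a cube representation -/

/-- The weight `±1 ∈ ℚ` of a Boolean sign vector. -/
def sgnQ {α : Type} (η : α → Bool) (p : α) : ℚ := if η p then 1 else -1

/-- The sign weight `±1` is non-zero in `ℝ`. [folklore] -/
theorem sgnQ_cast_ne_zero {α : Type} (η : α → Bool) (p : α) : (sgnQ η p : ℝ) ≠ 0 := by
  unfold sgnQ; split_ifs <;> norm_num

/-- The strict sign cell `C_η = {x | ∀ p ∈ F, η_p · p(x) > 0}`. -/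
def cellSet {N : ℕ} (F : Finset (MvPolynomial (Fin N) ℚ)) (η : F → Bool) : Set (Fin N → ℝ) :=
  {x | ∀ p : F, 0 < (sgnQ η p : ℝ) * aeval x (p : MvPolynomial (Fin N) ℚ)}

/-- The Walsh polynomial `g_{η,T} = ∏_{p ∈ T} η_p · p`. -/
def gPoly {N : ℕ} (F : Finset (MvPolynomial (Fin N) ℚ)) (η : F → Bool) (T : Finset F) :
    MvPolynomial (Fin N) ℚ :=
  ∏ p ∈ T, (C (sgnQ η p) * (p : MvPolynomial (Fin N) ℚ))

/-- The strict sign vector of a point. -/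
def signVec {N : ℕ} (F : Finset (MvPolynomial (Fin N) ℚ)) (x : Fin N → ℝ) : F → Bool :=
  fun p => decide (0 < aeval x (p : MvPolynomial (Fin N) ℚ))

/-- Evaluation of the Walsh polynomial: `g_{η,T}(x) = ∏_{p ∈ T} (η_p · p(x))`. [folklore] -/
theorem aeval_gPoly {N : ℕ} (F : Finset (MvPolynomial (Fin N) ℚ)) (η : F → Bool) (T : Finset F)
    (x : Fin N → ℝ) :
    aeval x (gPoly F η T) = ∏ p ∈ T, ((sgnQ η p : ℝ) * aeval x (p : MvPolynomial (Fin N) ℚ)) := by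
  simp only [gPoly, map_prod, map_mul, MvPolynomial.aeval_C, eq_ratCast]

/-- Off the zero sets, `x ∈ C_η ↔ η` is the sign vector of `x`. -/
theorem mem_cellSet_iff {N : ℕ} (F : Finset (MvPolynomial (Fin N) ℚ)) (η : F → Bool)
    {x : Fin N → ℝ} (hx : ∀ p : F, aeval x (p : MvPolynomial (Fin N) ℚ) ≠ 0) :
    x ∈ cellSet F η ↔ η = signVec F x := by
  constructor
  · intro h
    funext p
    have hp := h p
    rcases Bool.eq_false_or_eq_true (η p) with hb | hb
    · have hp' : 0 < aeval x (p : MvPolynomial (Fin N) ℚ) := by simpa [sgnQ, hb] using hp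
      simp [signVec, hb, hp']
    · have hp' : aeval x (p : MvPolynomial (Fin N) ℚ) < 0 := by
        have : 0 < -aeval x (p : MvPolynomial (Fin N) ℚ) := by simpa [sgnQ, hb] using hp
        linarith
      simp [signVec, hb, not_lt.mpr hp'.le]
  · rintro rfl p
    by_cases h0 : 0 < aeval x (p : MvPolynomial (Fin N) ℚ)
    · simp [sgnQ, signVec, h0]
    · have hneg : aeval x (p : MvPolynomial (Fin N) ℚ) < 0 := lt_of_le_of_ne (not_lt.mp h0) (hx p)
      have : 0 < -aeval x (p : MvPolynomial (Fin N) ℚ) := by linarith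
      simpa [sgnQ, signVec, h0] using this

open scoped Classical in
/-- Off the zero sets, `1_D = Σ_{η good} 1_{C_η}` for a set `D` sign-determined by `F`. -/
theorem sum_ite_mem_cellSet {N : ℕ} (F : Finset (MvPolynomial (Fin N) ℚ)) {D : Set (Fin N → ℝ)}
    (hF : ∀ x y : Fin N → ℝ, (∀ p ∈ F, SignType.sign (aeval x p) = SignType.sign (aeval y p)) →
      (x ∈ D ↔ y ∈ D))
    (Gd : Finset (F → Bool)) (hGd : ∀ η, η ∈ Gd ↔ cellSet F η ⊆ D)
    {x : Fin N → ℝ} (hx : ∀ p : F, aeval x (p : MvPolynomial (Fin N) ℚ) ≠ 0) :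
    ∑ η ∈ Gd, (if x ∈ cellSet F η then (1 : ℝ) else 0) = if x ∈ D then 1 else 0 := by
  classical
  have h1 : ∀ η ∈ Gd, (if x ∈ cellSet F η then (1 : ℝ) else 0) =
      if η = signVec F x then 1 else 0 := fun η _ => by
    by_cases h : x ∈ cellSet F η
    · rw [if_pos h, if_pos ((mem_cellSet_iff F η hx).mp h)]
    · rw [if_neg h, if_neg (fun h' => h ((mem_cellSet_iff F η hx).mpr h'))]
  rw [Finset.sum_congr rfl h1, Finset.sum_ite_eq']
  have key : signVec F x ∈ Gd ↔ x ∈ D := by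
    rw [hGd]
    constructor
    · intro hsub
      exact hsub ((mem_cellSet_iff F _ hx).mpr rfl)
    · intro hxD y hy
      refine (hF x y fun p hp => ?_).mp hxD
      have hyp := hy ⟨p, hp⟩
      by_cases h0 : 0 < aeval x p
      · have hy0 : 0 < aeval y p := by simpa [sgnQ, signVec, h0] using hyp
        rw [sign_pos h0, sign_pos hy0]
      · have hxneg : aeval x p < 0 := lt_of_le_of_ne (not_lt.mp h0) (hx ⟨p, hp⟩)
        have hy0 : aeval y p < 0 := by
          have : 0 < -aeval y p := by simpa [sgnQ, signVec, h0] using hyp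
          linarith
        rw [sign_neg hxneg, sign_neg hy0]
  by_cases hD : x ∈ D
  · rw [if_pos hD, if_pos (key.mpr hD)]
  · rw [if_neg hD, if_neg (fun h => hD (key.mp h))]

/-- **Walsh expansion (pointwise).** For nonzero reals `a p`:
`Σ_{T} sgn(∏_{p∈T} a p) = 2^{#Φ} · [∀ p, a p > 0]`. [folklore: expand `∏ (1 + sgn a_p)`] -/
theorem walsh_sum_sign {Φ : Type} [Fintype Φ] [DecidableEq Φ] (a : Φ → ℝ) (ha : ∀ p, a p ≠ 0) :
    ∑ T : Finset Φ, (if 0 < ∏ p ∈ T, a p then (1 : ℝ) else -1) =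
      2 ^ Fintype.card Φ * (if ∀ p, 0 < a p then (1 : ℝ) else 0) := by
  set s : Φ → ℝ := fun p => if 0 < a p then 1 else -1 with hs_def
  have hprod : ∀ T : Finset Φ, ∏ p ∈ T, s p = if 0 < ∏ p ∈ T, a p then (1 : ℝ) else -1 := by
    intro T
    induction T using Finset.induction_on with
    | empty => simp
    | insert p T hpT ih =>
      rw [Finset.prod_insert hpT, Finset.prod_insert hpT, ih]
      have hT : ∏ x ∈ T, a x ≠ 0 := Finset.prod_ne_zero_iff.mpr fun x _ => ha x
      simp only [hs_def]
      rcases Ne.lt_or_gt (ha p) with hp | hp <;> rcases Ne.lt_or_gt hT with hT' | hT'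
      · rw [if_neg (not_lt.mpr hp.le), if_neg (not_lt.mpr hT'.le),
          if_pos (mul_pos_of_neg_of_neg hp hT')]
        norm_num
      · rw [if_neg (not_lt.mpr hp.le), if_pos hT',
          if_neg (not_lt.mpr (mul_neg_of_neg_of_pos hp hT').le)]
        norm_num
      · rw [if_pos hp, if_neg (not_lt.mpr hT'.le),
          if_neg (not_lt.mpr (mul_neg_of_pos_of_neg hp hT').le)]
        norm_num
      · rw [if_pos hp, if_pos hT', if_pos (mul_pos hp hT')]
        norm_num
  have hexp : ∏ p, (1 + s p) = ∑ T : Finset Φ, ∏ p ∈ T, s p := by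
    rw [Finset.prod_one_add, Finset.powerset_univ]
  have hlhs : ∏ p, (1 + s p) = 2 ^ Fintype.card Φ * (if ∀ p, 0 < a p then (1 : ℝ) else 0) := by
    split_ifs with hall
    · have h2 : ∀ p ∈ (Finset.univ : Finset Φ), 1 + s p = 2 := fun p _ => by
        simp only [hs_def, if_pos (hall p)]; norm_num
      rw [Finset.prod_congr rfl h2, Finset.prod_const, Finset.card_univ, mul_one]
    · push Not at hall
      obtain ⟨p, hp⟩ := hall
      rw [mul_zero]
      exact Finset.prod_eq_zero (Finset.mem_univ p) (by
        simp only [hs_def, if_neg (not_lt.mpr hp)]; norm_num)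
  calc ∑ T : Finset Φ, (if 0 < ∏ p ∈ T, a p then (1 : ℝ) else -1)
      = ∑ T : Finset Φ, ∏ p ∈ T, s p := by simp_rw [hprod]
    _ = ∏ p, (1 + s p) := hexp.symm
    _ = _ := hlhs

/-- Indicator form of the Walsh expansion:
`2 Σ_T [∏_{p∈T} a p > 0] = 2^{#Φ} ([∀ p, a p > 0] + 1)`. -/
theorem walsh_sum_indicator {Φ : Type} [Fintype Φ] [DecidableEq Φ] (a : Φ → ℝ)
    (ha : ∀ p, a p ≠ 0) :
    2 * ∑ T : Finset Φ, (if 0 < ∏ p ∈ T, a p then (1 : ℝ) else 0) =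
      2 ^ Fintype.card Φ * ((if ∀ p, 0 < a p then (1 : ℝ) else 0) + 1) := by
  have h := walsh_sum_sign a ha
  have h2 : ∀ T : Finset Φ, (if 0 < ∏ p ∈ T, a p then (1 : ℝ) else -1) =
      2 * (if 0 < ∏ p ∈ T, a p then (1 : ℝ) else 0) - 1 := fun T => by
    split_ifs <;> norm_num
  simp_rw [h2] at h
  rw [Finset.sum_sub_distrib, ← Finset.mul_sum, Finset.sum_const, Finset.card_univ,
    Fintype.card_finset, nsmul_eq_mul, mul_one] at h
  push_cast at h
  linarith

end Summit.KontsevichZagierPeriods.RootDecompWalshStrata.WalshSpanProof
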